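import Summits.AtomisticToContinuum.HydrodynamicLimit.Theorems.RelayRaceLocalityLightConeInLawCSRLine
import Summits.AtomisticToContinuum.HydrodynamicLimit.Theorems.RelayRaceLocalityLightConeInLawCSRChargedAtomsA
import HarnessLib

/-!
# Crux `LightConeInLaw` (stmt-AtomisticToContinuum-12500), line `count-sufficiency-reduction` — stub `stub_chargedAtoms`

Registered statics stub 1b of the lead's skeleton `Cruxes/LightConeInLaw/Lines/count_sufficiency_reduction.lean`
(route `RelayRaceLocality`): **every count atom near the centre is charged by gas 1.** For the
canonical local Gibbs law of `N + 1` hard spheres of diameter `ε_N = hsDiameter σ₁ N` on `𝕋³`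
(a probability measure; continuous profiles, `a₁, θ₁ > 0`), a continuous density `ρ₁ > 0` of unit
mass obeying the packing guard `ρ₁ σ₁³ < η₀ := 1/64`, and a ball `B' = B(x₀, R')`, `R' > 0`,
missing a point, there is `δ₀ > 0` such that for all large `N` every atom `{ballCount x₀ R' = k}`
with `|k/(N+1) - ∫_{B'} ρ₁| ≤ δ₀` has positive probability.

Proof. The event is positional; the position marginal of the law is the configurational Gibbs
measure `Z_pos⁻¹ 𝟙_{no overlap} ∏ a₁(xᵢ) dx` (`localGibbsMeasure_preimage_pos`), with `Z_pos > 0`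
because the law has mass one, so it suffices (`ChargedAtoms.core`) to exhibit a positive-volume
set of non-overlapping configurations with count `k`. That is the packing lemma
`ChargedAtoms.chargedSet` of the sibling file `…CSRChargedAtomsA` at mesh `L_N = ⌊(2ε_N)⁻¹⌋₊`
(`mesh_spec`: `ε_N ≤ (2L_N)⁻¹`, `L_N³ ≥ (N+1)/(16σ₁³)`, `2/L_N → 0`), whose volume hypotheses hold on
the window: `k ≤ (m + δ₀)(N+1)` with `m = ∫_{B'} ρ₁ ≤ vol(B')/(64σ₁³)` (guard) and
`vol B(x₀, R' - 2/L_N) > vol(B')/2` eventually (continuity from below, `exists_shrink`); and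
`N + 1 - k ≤ (1 - m + δ₀)(N+1)` with `1 - m = ∫_{dist ≥ R'} ρ₁ ≤ vol{dist > R'}/(64σ₁³)` (unit
mass, guard, null sphere `Torus.volume_euclidDist_eq`), `vol{dist > R' + 2/L_N} > vol{dist > R'}/2`
eventually; `δ₀ = min(vol B', vol{dist > R'})/(64σ₁³) ∧ (1 - m)/2`. No definitions, no named facts.
-/

namespace Summit.AtomisticToContinuum.HydrodynamicLimit.Theorems.LightConeInLawCSR

open scoped BigOperators Topology Classical ENNReal ProbabilityTheory
open Filter Set MeasureTheory ProbabilityTheory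
open Literature.MathematicalPhysics.KineticTheory Literature.Analysis.FluidPDE
open Summit.AtomisticToContinuum.HydrodynamicLimit.Theorems.LightConeInLawSketch

noncomputable section

/-- **Charged atoms, positional form.** For `σ > 0`, a continuous `ρ > 0` of unit mass with
`ρ σ³ < 1/64`, and a ball `B(x₀, R')`, `R' > 0`, missing a point of `𝕋³`, there is `δ₀ > 0` such
that for all large `N` and every `k` with `|k/(N+1) - ∫_{B(x₀,R')} ρ| ≤ δ₀` some measurable set of
positive volume consists of position configurations pairwise at minimal-image distance
`≥ hsDiameter σ N` with exactly `k` points in the ball (the volume hypotheses of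
`ChargedAtoms.chargedSet` at mesh `L = ⌊(2 ε_N)⁻¹⌋₊`, verified as in the file header). -/
theorem ChargedAtoms.core {σ : ℝ} (hσ : 0 < σ) {ρ : T3 → ℝ} (hρ : Continuous ρ)
    (hρ0 : ∀ x, 0 < ρ x) (hρ1 : ∫ x, ρ x = 1) {x₀ : T3} {R' : ℝ} (hR' : 0 < R')
    (hy : ∃ y, R' < Torus.euclidDist y x₀) (hguard : ∀ x, ρ x * σ ^ 3 < 1 / 64) :
    ∃ δ₀ : ℝ, 0 < δ₀ ∧ ∀ᶠ N : ℕ in atTop, ∀ k : ℕ,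
      |(k : ℝ) / ((N : ℝ) + 1) - ∫ x in {x | Torus.euclidDist x x₀ < R'}, ρ x| ≤ δ₀ →
        ∃ T : Set (Fin (N + 1) → T3), MeasurableSet T ∧ volume T ≠ 0 ∧
          T ⊆ {x | (∀ i j, i ≠ j → hsDiameter σ N ≤ Torus.euclidDist (x i) (x j)) ∧
            (Finset.univ.filter fun i : Fin (N + 1) => Torus.euclidDist (x i) x₀ < R').card = k} := by
  set B : Set T3 := {x | Torus.euclidDist x x₀ < R'} with hB
  set E : Set T3 := {x | R' < Torus.euclidDist x x₀} with hE
  set m : ℝ := ∫ x in B, ρ x with hm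
  have hcont : Continuous fun x : T3 => Torus.euclidDist x x₀ :=
    Torus.continuous_euclidDist.comp₂ continuous_id continuous_const
  have hBo : IsOpen B := isOpen_lt hcont continuous_const
  have hEo : IsOpen E := isOpen_lt continuous_const hcont
  have hBpos : 0 < volume B :=
    hBo.measure_pos volume ⟨x₀, by simp only [hB, mem_setOf_eq, Torus.euclidDist_self]; exact hR'⟩
  have hEpos : 0 < volume E := hEo.measure_pos volume hy
  have hBtop : volume B ≠ ⊤ := measure_ne_top _ _
  have hEtop : volume E ≠ ⊤ := measure_ne_top _ _
  set VB : ℝ := (volume B).toReal with hVBdef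
  set VE : ℝ := (volume E).toReal with hVEdef
  have hVB : 0 < VB := ENNReal.toReal_pos hBpos.ne' hBtop
  have hVE : 0 < VE := ENNReal.toReal_pos hEpos.ne' hEtop
  -- mass bounds from the guard, unit mass and the null sphere
  have hc : ∀ x, ρ x ≤ 1 / (64 * σ ^ 3) := fun x => by
    rw [le_div_iff₀ (by positivity)]
    linarith [hguard x]
  have hρi : Integrable ρ := integrable_of_continuous_T3 hρ
  have hm_le : m ≤ VB / (64 * σ ^ 3) := by
    calc m ≤ ∫ x in B, (1 / (64 * σ ^ 3) : ℝ) :=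
          setIntegral_mono hρi.integrableOn (integrableOn_const hBtop) fun x => hc x
      _ = VB / (64 * σ ^ 3) := by rw [setIntegral_const, smul_eq_mul, measureReal_def]; ring
  have h1m : 1 - m = ∫ x in Bᶜ, ρ x := by
    have := integral_add_compl hBo.measurableSet hρi
    linarith
  have hcompl_le : volume Bᶜ ≤ volume E := by
    have hsub : Bᶜ ⊆ E ∪ {x | Torus.euclidDist x x₀ = R'} := by
      intro x hx
      simp only [hB, mem_compl_iff, mem_setOf_eq, not_lt] at hx
      rcases hx.lt_or_eq with h | h
      · exact Or.inl h
      · exact Or.inr h.symm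
    calc volume Bᶜ ≤ volume (E ∪ {x | Torus.euclidDist x x₀ = R'}) := measure_mono hsub
      _ ≤ volume E + volume {x : T3 | Torus.euclidDist x x₀ = R'} := measure_union_le _ _
      _ = volume E := by rw [Torus.volume_euclidDist_eq hR'.ne' x₀, add_zero]
  have h1m_le : 1 - m ≤ VE / (64 * σ ^ 3) := by
    rw [h1m]
    calc ∫ x in Bᶜ, ρ x ≤ ∫ x in Bᶜ, (1 / (64 * σ ^ 3) : ℝ) :=
          setIntegral_mono hρi.integrableOn (integrableOn_const (measure_ne_top _ _)) fun x => hc x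
      _ = (volume Bᶜ).toReal / (64 * σ ^ 3) := by
          rw [setIntegral_const, smul_eq_mul, measureReal_def]; ring
      _ ≤ VE / (64 * σ ^ 3) := by
          gcongr
          exact ENNReal.toReal_mono hEtop hcompl_le
  have hm_lt : m < 1 := by
    have : 0 < ∫ x in Bᶜ, ρ x := by
      rw [setIntegral_pos_iff_support_of_nonneg_ae (Eventually.of_forall fun x => (hρ0 x).le)
        hρi.integrableOn]
      have hsupp : Function.support ρ = univ := by
        ext x
        simp [(hρ0 x).ne']
      rw [hsupp, univ_inter]
      refine lt_of_lt_of_le hEpos (measure_mono fun x hx => ?_)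
      simp only [hB, hE, mem_compl_iff, mem_setOf_eq, not_lt] at hx ⊢
      exact hx.le
    linarith
  -- the window half-width
  set δ₀ : ℝ := min (min VB VE / (64 * σ ^ 3)) ((1 - m) / 2) with hδ₀def
  have hδB : δ₀ ≤ VB / (64 * σ ^ 3) :=
    (min_le_left _ _).trans (div_le_div_of_nonneg_right (min_le_left _ _) (by positivity))
  have hδE : δ₀ ≤ VE / (64 * σ ^ 3) :=
    (min_le_left _ _).trans (div_le_div_of_nonneg_right (min_le_right _ _) (by positivity))
  have hδm : δ₀ ≤ (1 - m) / 2 := min_le_right _ _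
  refine ⟨δ₀, lt_min (by positivity) (by linarith), ?_⟩
  -- inner approximation of the ball and of the exterior
  obtain ⟨sB, hsB, hvB⟩ := exists_shrink volume (fun y : T3 => Torus.euclidDist y x₀) R'
    (v := volume B / 2) (ENNReal.half_lt_self hBpos.ne' hBtop)
  have hE' : {y : T3 | (fun y : T3 => -Torus.euclidDist y x₀) y < -R'} = E := by
    ext y
    simp only [mem_setOf_eq, hE]
    constructor <;> intro h <;> linarith
  obtain ⟨sE, hsE, hvE⟩ := exists_shrink volume (fun y : T3 => -Torus.euclidDist y x₀) (-R')
    (v := volume E / 2) (by rw [hE']; exact ENNReal.half_lt_self hEpos.ne' hEtop)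
  -- large `N`
  have hev : ∀ᶠ N : ℕ in atTop, hsDiameter σ N < min (1 / 12) (min (sB / 5) (sE / 5)) :=
    (tendsto_order.1 (tendsto_hsDiameter σ)).2 _ (by positivity)
  filter_upwards [hev] with N hN k hk
  set L : ℕ := ⌊1 / (2 * hsDiameter σ N)⌋₊ with hLdef
  obtain ⟨hL, hεL, hL3, h2L⟩ := mesh_spec hσ (hN.le.trans (min_le_left _ _))
    (Nat.floor_le (by have := hsDiameter_pos hσ N; positivity)) (Nat.lt_floor_add_one _)
  have hN2 : hsDiameter σ N < sB / 5 :=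
    lt_of_lt_of_le hN ((min_le_right _ _).trans (min_le_left _ _))
  have hN3 : hsDiameter σ N < sE / 5 :=
    lt_of_lt_of_le hN ((min_le_right _ _).trans (min_le_right _ _))
  -- the window
  have hN1 : (0 : ℝ) < (N : ℝ) + 1 := by positivity
  have hk1 : (k : ℝ) ≤ (m + δ₀) * ((N : ℝ) + 1) := by
    rw [← div_le_iff₀ hN1]
    linarith [(abs_le.1 hk).2]
  have hk2 : ((N : ℝ) + 1) * (m - δ₀) ≤ k := by
    have h' : m - δ₀ ≤ k / ((N : ℝ) + 1) := by linarith [(abs_le.1 hk).1]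
    rwa [le_div_iff₀ hN1, mul_comm] at h'
  have hkn : k ≤ N + 1 := by
    have h2 : (k : ℝ) ≤ (N : ℝ) + 1 := hk1.trans (mul_le_of_le_one_left hN1.le (by linarith))
    exact_mod_cast h2
  have keyB : VB / (64 * σ ^ 3) + VB / (64 * σ ^ 3) = VB / (32 * σ ^ 3) := by ring
  have keyE : VE / (64 * σ ^ 3) + VE / (64 * σ ^ 3) = VE / (32 * σ ^ 3) := by ring
  refine chargedSet hL hεL x₀ R' hkn ?_ ?_
  · -- enough room inside the ball
    have h2 : VB / 2 ≤ (volume {y : T3 | Torus.euclidDist y x₀ < R' - 2 / (L : ℝ)}).toReal := by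
      have h3 : volume B / 2 ≤ volume {y : T3 | Torus.euclidDist y x₀ < R' - 2 / (L : ℝ)} :=
        hvB.le.trans (measure_mono fun y hy => by
          simp only [mem_setOf_eq] at hy ⊢
          linarith)
      have h4 := ENNReal.toReal_mono (measure_ne_top _ _) h3
      rw [ENNReal.toReal_div] at h4
      simpa using h4
    calc (k : ℝ) ≤ (m + δ₀) * ((N : ℝ) + 1) := hk1
      _ ≤ VB / (32 * σ ^ 3) * ((N : ℝ) + 1) := by gcongr; linarith
      _ = ((N : ℝ) + 1) / (16 * σ ^ 3) * (VB / 2) := by ring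
      _ ≤ (L : ℝ) ^ 3 *
            (volume {y : T3 | Torus.euclidDist y x₀ < R' - 2 / (L : ℝ)}).toReal := by
          gcongr
  · -- enough room outside the ball
    have h2 : VE / 2 ≤ (volume {y : T3 | R' + 2 / (L : ℝ) < Torus.euclidDist y x₀}).toReal := by
      have h3 : volume E / 2 ≤ volume {y : T3 | R' + 2 / (L : ℝ) < Torus.euclidDist y x₀} :=
        hvE.le.trans (measure_mono fun y hy => by
          simp only [mem_setOf_eq] at hy ⊢
          linarith)
      have h4 := ENNReal.toReal_mono (measure_ne_top _ _) h3
      rw [ENNReal.toReal_div] at h4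
      simpa using h4
    push_cast
    calc (N : ℝ) + 1 - k ≤ (1 - m + δ₀) * ((N : ℝ) + 1) := by linarith
      _ ≤ VE / (32 * σ ^ 3) * ((N : ℝ) + 1) := by gcongr; linarith
      _ = ((N : ℝ) + 1) / (16 * σ ^ 3) * (VE / 2) := by ring
      _ ≤ (L : ℝ) ^ 3 *
            (volume {y : T3 | R' + 2 / (L : ℝ) < Torus.euclidDist y x₀}).toReal := by
          gcongr

open ChargedAtoms in
/-- **STUB 1b `stub_chargedAtoms` — every count atom near the centre is charged.** For the
canonical local Gibbs law of `N + 1` hard spheres of diameter `hsDiameter σ₁ N` on `𝕋³`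
(continuous profiles `a₁, θ₁ > 0`, `u₁`; a probability measure), a continuous `ρ₁ > 0` of unit
mass with packing `ρ₁ σ₁³ < η₀ = 1/64`, and a ball `B(x₀, R')`, `R' > 0`, missing a point: there is
`δ₀ > 0` such that for all large `N` every count atom `{ballCount x₀ R' = k}` with
`|k/(N+1) - ∫_{B(x₀,R')} ρ₁| ≤ δ₀` has positive probability. The event is positional, its law the
configurational Gibbs measure with density `Z_pos⁻¹ 𝟙_{no overlap} ∏ a₁(xᵢ) > 0` on the
non-overlap set (`Z_pos > 0` by unit mass), and `ChargedAtoms.core` supplies a positive-volume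
set of non-overlapping configurations with count `k`. -/
theorem stub_chargedAtoms :
    ∃ η₀ : ℝ, 0 < η₀ ∧
    ∀ (a₁ θ₁ : T3 → ℝ) (u₁ : T3 → V3), Continuous a₁ → Continuous θ₁ → Continuous u₁ →
      (∀ x, 0 < a₁ x) → (∀ x, 0 < θ₁ x) →
    ∀ σ₁ : ℝ, 0 < σ₁ →
    ∀ Φ₁ : (N : ℕ) → HardSphereFlow G3 (hsDiameter σ₁ N) (N + 1),
    (∀ N, IsProbabilityMeasure (localGibbsLaw σ₁ a₁ u₁ θ₁ N (Φ₁ N))) →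
    ∀ ρ₁ : T3 → ℝ, Continuous ρ₁ → (∀ x, 0 < ρ₁ x) → (∫ x, ρ₁ x) = 1 →
    ∀ (x₀ : T3) (R' : ℝ), 0 < R' → (∃ y, R' < Torus.euclidDist y x₀) →
      (∀ x, ρ₁ x * σ₁ ^ 3 < η₀) →
    ∃ δ₀ : ℝ, 0 < δ₀ ∧ ∀ᶠ (N : ℕ) in atTop, ∀ k : ℕ,
      |(k : ℝ) / ((N : ℝ) + 1) - ∫ x in {x | Torus.euclidDist x x₀ < R'}, ρ₁ x| ≤ δ₀ →
        localGibbsLaw σ₁ a₁ u₁ θ₁ N (Φ₁ N) (ballCount x₀ R' ⁻¹' {k}) ≠ 0 := by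
  refine ⟨1 / 64, by norm_num, ?_⟩
  intro a₁ θ₁ u₁ ha hθ hu ha0 hθ0 σ₁ hσ Φ₁ hP ρ₁ hρ hρ0 hρ1 x₀ R' hR' hy hguard
  obtain ⟨δ₀, hδ₀, hev⟩ := core hσ hρ hρ0 hρ1 hR' hy hguard
  refine ⟨δ₀, hδ₀, ?_⟩
  filter_upwards [hev] with N hN k hk
  obtain ⟨T, hTm, hT0, hTsub⟩ := hN k hk
  have ha0' : ∀ x, 0 ≤ a₁ x := fun x => (ha0 x).le
  -- the configurational partition function is positive (the law has mass one)
  have hZ : 0 < posPartition a₁ (hsDiameter σ₁ N) (N + 1) := by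
    haveI h1 : IsProbabilityMeasure (localGibbsMeasure σ₁ a₁ u₁ θ₁ N) := by
      rw [← localGibbsLaw_eq σ₁ a₁ u₁ θ₁ N (Φ₁ N)]
      exact hP N
    have h2 := localGibbsMeasure_univ ha hθ hu ha0' hθ0 σ₁ N
    rw [measure_univ] at h2
    refine lt_of_not_ge fun hle => ?_
    rw [ENNReal.ofReal_of_nonpos hle, mul_zero] at h2
    exact one_ne_zero h2
  -- the charged set sits below the atom
  have hsub : (fun z : Config (N + 1) (Fin 3) T3 => fun i => (z i).1) ⁻¹' T ⊆
      ballCount x₀ R' ⁻¹' {k} := fun z hz => (hTsub hz).2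
  rw [localGibbsLaw_eq]
  intro h0
  have h1 := measure_mono_null hsub h0
  rw [localGibbsMeasure_preimage_pos ha hθ hu ha0' hθ0 σ₁ N hTm, posGibbsMeasure,
    withDensity_apply _ hTm] at h1
  have hpos : 0 < ∫⁻ x in T, ENNReal.ofReal ((posPartition a₁ (hsDiameter σ₁ N) (N + 1))⁻¹ *
      posWeight a₁ (hsDiameter σ₁ N) (N + 1) x) := by
    rw [setLIntegral_pos_iff
      ((measurable_posWeight ha (hsDiameter σ₁ N) (N + 1)).const_mul _).ennreal_ofReal]
    have hsupp : T ⊆ Function.support fun x => ENNReal.ofReal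
        ((posPartition a₁ (hsDiameter σ₁ N) (N + 1))⁻¹ * posWeight a₁ (hsDiameter σ₁ N) (N + 1) x) := by
      intro x hx
      have hxD : x ∈ posDomain (hsDiameter σ₁ N) (N + 1) := (hTsub hx).1
      rw [Function.mem_support, ne_eq, ENNReal.ofReal_eq_zero, not_le]
      refine mul_pos (inv_pos.2 hZ) ?_
      rw [posWeight, indicator_of_mem hxD]
      exact Finset.prod_pos fun i _ => ha0 (x i)
    rw [inter_eq_self_of_subset_right hsupp]
    exact pos_iff_ne_zero.2 hT0
  exact hpos.ne' h1

end

end Summit.AtomisticToContinuum.HydrodynamicLimit.Theorems.LightConeInLawCSR
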